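import Mathlib
import Literature.Combinatorics.Kakeya.FiniteFieldKakeya
import HarnessLib

/-!
# Kakeya sets in `𝔽_qⁿ` have at least `(q/4)ⁿ` points (Saraf–Sudan 2008, Theorem 1, Lemma 6)

Topic `Literature/Combinatorics/Kakeya`.  Everything in this file is PROVED (no named fact, no
`sorry`).  Companion to `FiniteFieldKakeya.lean` (Dvir 2009: `|K| ≥ C(q + n − 1, n) ≥ qⁿ / n!`):
the first improvement of Dvir's constant by the METHOD OF MULTIPLICITIES — a polynomial vanishing
to order `m` on the Kakeya set — which pins the constant down to exponential shape `βⁿ`.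

S. Saraf, M. Sudan, *An improved lower bound on the size of Kakeya sets over finite fields*,
Analysis & PDE **1** (2008), no. 3, 375–379 (doi:10.2140/apde.2008.1.375; arXiv:0808.2499),
verbatim from the printed text:

> (p. 375) Let `𝔽` be a finite field with `q` elements. A set `K ⊆ 𝔽ⁿ` is said to be a Kakeya
> set in `𝔽ⁿ` if, for every `b ∈ 𝔽ⁿ`, there exists a point `a ∈ 𝔽ⁿ` such that, for every `t ∈ 𝔽`,
> the point `a + tb` lies in `K`. […]
> **Theorem 1.** There exist constants `c₀, c₁ > 0` such that for all `n`, if `K` is a Kakeya set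
> in `𝔽ⁿ` then `|K| ≥ c₀ (c₁ q)ⁿ`.
>
> (§1, p. 376) **Fact 2.** Let `P ∈ 𝔽[x]` be a polynomial of degree at most `q − 1` in each
> variable. If `P(a) = 0` for all `a ∈ 𝔽ⁿ`, then `P ≡ 0`.
> For integer `m ≥ 0`, let `N_q(n, m)` denote the number of monomials in `n` variables of total
> degree less than `mq` and of individual degree at most `q − 1` in each variable.
> We say that a polynomial `g ∈ 𝔽[x]` has a zero of multiplicity `m` at a point `a ∈ 𝔽ⁿ` if the
> polynomial `g_a(x) = g(x + a)` has no support on monomials of degree strictly less than `m`. […]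
> **Proposition 3.** Given a set `S ⊆ 𝔽ⁿ` satisfying `C(m + n − 1, n) |S| < N_q(n, m)`, there
> exists a nonzero polynomial `g ∈ 𝔽[x]` of total degree less than `mq` and degree at most `q − 1`
> in each variable such that `g` has a zero of multiplicity `m` at every point `a ∈ S`.
> **Proposition 4.** If `g ∈ 𝔽[x]` has a root of multiplicity `m` at some point `a + t₀b` then
> `g_{a,b}` has a root of multiplicity `m` at `t₀`.  [`g_{a,b}(t) = g(a + tb)`]
> **Proposition 5** [Dvir 2008]. Let `g ∈ 𝔽[x]` be a nonzero polynomial of total degree `d` and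
> let `g₀` be the (unique, nonzero) homogeneous polynomial of degree `d` such that `g = g₀ + g₁`
> for some polynomial `g₁` of degree strictly less than `d`. Then `g_{a,b}(t) = g₀(b)t^d + h(t)`
> where `h` is a polynomial of degree strictly less than `d`.
>
> (§2, p. 377) **Lemma 6.** If `K` is a Kakeya set in `𝔽ⁿ`, then for every integer `m ≥ 0`,
> `|K| ≥ C(m + n − 1, n)⁻¹ N_q(n, m)`.
> *Proof of Theorem 1.* The theorem now follows by choosing `m` appropriately. Using for
> instance `m = n`, we obtain `|K| ≥ C(2n − 1, n)⁻¹ N_q(n, n)`. It easily follows by the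
> definition of `N_q(n, m)` that `N_q(n, n) = qⁿ` […]. Hence `|K| ≥ C(2n − 1, n)⁻¹ qⁿ ≥ (q/4)ⁿ`,
> establishing the theorem for `c₀ = 1` and `c₁ = 1/4`.

## What is proved

* `shift a g` (def, `= g(x + a)`), `VanishesToOrder g a m` (def: "`g` has a zero of multiplicity
  `m` at `a`", the printed definition), `boxExps q n`, `admExps q n m` (defs: the exponent vectors
  with all entries `≤ q − 1`, resp. also of total degree `< mq`), `Nq q n m` (def: `N_q(n, m)`).
* `eq_zero_of_forall_eval_eq_zero` — **Fact 2** (by induction on `n`; Mathlib's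
  `MvPolynomial.eq_zero_of_eval_eq_zero` is the same statement but restricted to a variable type
  and a field in a common universe).
* `exists_vanishesToOrder` — **Proposition 3** (interpolation with multiplicity; `m ≥ 1`, any `q`).
* `X_sub_C_pow_dvd_aeval_line` — **Proposition 4** (`(t − t₀)^m ∣ g_{a,b}`); and its consequence
  "counting up the zeroes" `aeval_line_eq_zero_of_vanishesToOrder` (`g_{a,b} ≡ 0` once
  `deg g < mq` and `g` has multiplicity `m` at every point of the line).  Proposition 5 is
  `FiniteFieldKakeya.coeff_aeval_line` of the Dvir file.
* `Nq_le_choose_mul_card` — **Lemma 6**, in the form `N_q(n, m) ≤ C(m + n − 1, n) · |K|`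
  (every `m`; for `m = 0`, `n ≥ 1` both printed sides degenerate).
* `pow_le_choose_mul_card` — **Theorem 1 as proved (`m = n`): every Kakeya set `K ⊆ 𝔽_qⁿ` has
  `qⁿ ≤ C(2n − 1, n) · |K|`**; `pow_le_four_pow_mul_card` — hence **`qⁿ ≤ 4ⁿ · |K|`**, i.e.
  `|K| ≥ (q/4)ⁿ` (`c₀ = 1`, `c₁ = 1/4`); `pow_le_choose_mul_ncard`, `pow_le_four_pow_mul_ncard` —
  the same for `Set`s; `Nq_self` (`N_q(n, n) = qⁿ`, `n ≥ 1`).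
* `pow_le_two_mul_Nq` — "at least half the monomials of individual degree at most `q − 1` have
  degree at most `nq/2`": `qⁿ ≤ 2 N_q(n, m)` for `n ≤ 2m`; `pow_le_two_mul_choose_mul_card`,
  `pow_le_two_mul_choose_half_mul_card` — **the second choice `m = ⌈n/2⌉`:
  `qⁿ ≤ 2 C(⌈n/2⌉ + n − 1, n) · |K|`** (printed: `|K| ≥ ½ C(3n/2, n)⁻¹ qⁿ`).

The proofs follow the printed ones step by step; the linear algebra of Proposition 3 is made
explicit (the constraint "coefficient of `x^e` in `g(x + a)` vanishes for `|e| ≤ m − 1`" is indexed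
by the exponents `f` on `n + 1` letters with `|f| = m − 1`, `e = f ∘ some`, which are
`C(m + n − 1, n)` in number), and "counting up the zeroes of `g_{a,b}`" is done by divisibility by
`∏_{t₀ ∈ 𝔽} (t − t₀)^m`, a polynomial of degree `mq > deg g_{a,b}`.

## Not in this file

* The numerical form `½ (q/2.6)ⁿ` of the `m = ⌈n/2⌉` bound (an estimate of `C(3n/2, n)`), the
  asymptotic discussion of `N_q(n, αn)` (Eulerian numbers) and the Remark (`n = 3`, `m = 2`:
  `|K| ≥ (5/24) q³` asymptotically).
* The later constants: Dvir–Kopparty–Saraf–Sudan (`|K| ≥ qⁿ/2ⁿ`, Hasse derivatives and the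
  multiplicity Schwartz–Zippel lemma), Bukh–Chao (`|K| ≥ qⁿ/(2 − 1/q)^{n−1}`).
* The upper bound of §3 (Theorem 7) is the companion file `SmallKakeyaSets.lean`.

## References
* [SarafSudan2008KakeyaFiniteFields] S. Saraf, M. Sudan, Analysis & PDE 1 (2008), no. 3, 375–379 —
  Theorem 1 (p. 375), Fact 2, Propositions 3–5 (§1, p. 376), Lemma 6 and the proof of Theorem 1
  (§2, p. 377); arXiv:0808.2499 numbers these Theorem 2, Fact 3, Propositions 4–6, Lemma 7.
* [Dvir2009FiniteFieldKakeya] Z. Dvir, J. Amer. Math. Soc. 22 (2009) 1093–1097 — the definition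
  of a Kakeya set (`IsKakeya`) and Proposition 5 (`coeff_aeval_line`), file
  `FiniteFieldKakeya.lean`.
-/

namespace Literature.Combinatorics.Kakeya

namespace FiniteFieldKakeya

open MvPolynomial Finset

variable {K : Type*} [Field K]

/-! ### Fact 2: a reduced polynomial vanishing everywhere is zero -/

/-- **Fact 2.** A polynomial over `𝔽_q` of degree `< q` in each variable which vanishes at every
point of `𝔽_qⁿ` is the zero polynomial (induction on `n`: as a polynomial in `x₀` with
coefficients in `𝔽[x₁, …, x_n]`, every specialisation of the coefficients has `q` roots and degree
`< q`). [cite: SarafSudan2008KakeyaFiniteFields, Fact 2 (§1, p. 376)] -/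
theorem eq_zero_of_forall_eval_eq_zero [Fintype K] :
    ∀ {n : ℕ} (p : MvPolynomial (Fin n) K), (∀ i, degreeOf i p < Fintype.card K) →
      (∀ x : Fin n → K, eval x p = 0) → p = 0
  | 0, p, _, h => by
    have h0 := h Fin.elim0
    rw [p.eq_C_of_isEmpty, eval_C] at h0
    rw [p.eq_C_of_isEmpty, h0, C_0]
  | n + 1, p, hdeg, h => by
    classical
    have hcoeff : ∀ i, Polynomial.coeff (finSuccEquiv K n p) i = 0 := by
      intro i
      refine eq_zero_of_forall_eval_eq_zero _ (fun j => ?_) (fun y => ?_)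
      · exact (degreeOf_coeff_finSuccEquiv p j i).trans_lt (hdeg j.succ)
      · have hQ : Polynomial.map (eval y) (finSuccEquiv K n p) = 0 := by
          refine Polynomial.eq_zero_of_natDegree_lt_card_of_eval_eq_zero' _ Finset.univ
            (fun t _ => ?_) ?_
          · rw [← eval_eq_eval_mv_eval']
            exact h _
          · calc (Polynomial.map (eval y) (finSuccEquiv K n p)).natDegree
                ≤ (finSuccEquiv K n p).natDegree := Polynomial.natDegree_map_le
              _ = degreeOf 0 p := natDegree_finSuccEquiv p
              _ < Fintype.card K := hdeg 0
              _ = #(univ : Finset K) := Finset.card_univ.symm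
        have := congrArg (fun Q => Polynomial.coeff Q i) hQ
        simpa only [Polynomial.coeff_map, Polynomial.coeff_zero] using this
    have hP0 : finSuccEquiv K n p = 0 := Polynomial.ext fun i => by
      rw [hcoeff i, Polynomial.coeff_zero]
    calc p = (finSuccEquiv K n).symm (finSuccEquiv K n p) :=
        ((finSuccEquiv K n).symm_apply_apply p).symm
      _ = 0 := by rw [hP0, map_zero]

/-! ### Zeros of multiplicity `m` -/

/-- The shifted polynomial `g_a(x) = g(x + a)`. [cite: SarafSudan2008KakeyaFiniteFields, §1
(p. 376)] -/
noncomputable def shift {σ : Type*} (a : σ → K) (g : MvPolynomial σ K) : MvPolynomial σ K :=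
  aeval (fun i => X i + C (a i)) g

/-- `shift a g = g(x + a)`, as an `aeval`. [folklore] -/
theorem shift_eq {σ : Type*} (a : σ → K) (g : MvPolynomial σ K) :
    shift a g = aeval (fun i => X i + C (a i)) g :=
  rfl

/-- **"`g` has a zero of multiplicity `m` at `a`"** (§1, p. 376): `g(x + a)` has no support on
monomials of degree strictly less than `m`. [cite: SarafSudan2008KakeyaFiniteFields, §1 (p. 376)] -/
def VanishesToOrder {σ : Type*} (g : MvPolynomial σ K) (a : σ → K) (m : ℕ) : Prop :=
  ∀ s ∈ (shift a g).support, m ≤ s.degree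

/-- Unfolding lemma for `VanishesToOrder`. [folklore] -/
theorem vanishesToOrder_iff {σ : Type*} (g : MvPolynomial σ K) (a : σ → K) (m : ℕ) :
    VanishesToOrder g a m ↔ ∀ s ∈ (shift a g).support, m ≤ s.degree :=
  Iff.rfl

/-- Every polynomial vanishes to order `0` everywhere. [folklore] -/
theorem vanishesToOrder_zero {σ : Type*} (g : MvPolynomial σ K) (a : σ → K) :
    VanishesToOrder g a 0 :=
  fun _ _ => Nat.zero_le _

/-! ### Proposition 4: restriction to a line -/

/-- The restriction `g_{a,b}(t) = g(a + tb)` computed through the shift at `a + t₀ b`: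
`g(a + tb) = g_{a + t₀b}((t − t₀) b)`. [folklore] -/
theorem aeval_line_eq_aeval_shift {σ : Type*} (a b : σ → K) (t₀ : K) (g : MvPolynomial σ K) :
    aeval (fun i => Polynomial.C (a i) + Polynomial.C (b i) * Polynomial.X) g =
      aeval (fun i => (Polynomial.X - Polynomial.C t₀) * Polynomial.C (b i))
        (shift (a + t₀ • b) g) := by
  have h := comp_aeval (R := K) (f := fun i => X i + C ((a + t₀ • b) i))
    (aeval (R := K) fun i => (Polynomial.X - Polynomial.C t₀) * Polynomial.C (b i))
  have hg := AlgHom.congr_fun h g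
  rw [AlgHom.comp_apply] at hg
  rw [shift_eq, hg]
  have hfun : (fun i => Polynomial.C (a i) + Polynomial.C (b i) * Polynomial.X) = fun i =>
      aeval (R := K) (fun i => (Polynomial.X - Polynomial.C t₀) * Polynomial.C (b i))
        (X i + C ((a + t₀ • b) i)) := by
    funext i
    simp only [map_add, aeval_X, aeval_C, Polynomial.algebraMap_eq, Pi.add_apply, Pi.smul_apply,
      smul_eq_mul, Polynomial.C_mul]
    ring
  rw [hfun]

/-- **Proposition 4** ("if `g` has a root of multiplicity `m` at `a + t₀b` then `g_{a,b}` has a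
root of multiplicity `m` at `t₀`"): `(t − t₀)^m` divides `g(a + tb)`, because under the
substitution `x ← (t − t₀) b` every monomial of `g_{a + t₀ b}` of degree `≥ m` becomes a multiple
of `(t − t₀)^m`. [cite: SarafSudan2008KakeyaFiniteFields, Proposition 4 (§1, p. 376)] -/
theorem X_sub_C_pow_dvd_aeval_line {σ : Type*} (a b : σ → K) (t₀ : K) (g : MvPolynomial σ K)
    {m : ℕ} (h : VanishesToOrder g (a + t₀ • b) m) :
    (Polynomial.X - Polynomial.C t₀) ^ m ∣
      aeval (fun i => Polynomial.C (a i) + Polynomial.C (b i) * Polynomial.X) g := by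
  rw [aeval_line_eq_aeval_shift a b t₀, MvPolynomial.aeval_eq_eval₂Hom, MvPolynomial.coe_eval₂Hom,
    MvPolynomial.eval₂_eq]
  refine Finset.dvd_sum fun s hs => Dvd.dvd.mul_left ?_ _
  rw [Finset.prod_congr rfl fun i _ => mul_pow _ _ (s i), Finset.prod_mul_distrib,
    Finset.prod_pow_eq_pow_sum]
  have hm : m ≤ ∑ i ∈ s.support, s i := by
    have := h s hs
    rwa [Finsupp.degree_apply] at this
  exact Dvd.dvd.mul_right (pow_dvd_pow _ hm) _

/-- **"Counting up the zeroes of `g_{a,b}`"** (proof of Lemma 6, p. 377): if `deg g < mq` and `g`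
has a zero of multiplicity `m` at every point `a + t₀ b`, `t₀ ∈ 𝔽_q`, of a line, then the
restriction `g_{a,b}` is identically zero — it is divisible by `∏_{t₀} (t − t₀)^m`, of degree `mq`.
[cite: SarafSudan2008KakeyaFiniteFields, Lemma 6 (proof, §2, p. 377)] -/
theorem aeval_line_eq_zero_of_vanishesToOrder [Fintype K] {σ : Type*} (a b : σ → K)
    (g : MvPolynomial σ K) {m : ℕ} (hdeg : g.totalDegree < m * Fintype.card K)
    (h : ∀ t₀ : K, VanishesToOrder g (a + t₀ • b) m) :
    aeval (fun i => Polynomial.C (a i) + Polynomial.C (b i) * Polynomial.X) g = 0 := by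
  classical
  by_contra hP
  have hc := Polynomial.pairwise_coprime_X_sub_C (K := K) (s := id) Function.injective_id
  have hcop : Pairwise
      (Function.onFun IsCoprime fun t₀ : K => (Polynomial.X - Polynomial.C t₀) ^ m) :=
    hc.mono fun x y hxy => by exact hxy.pow
  have hdvd := Finset.prod_dvd_of_coprime (hcop.set_pairwise _)
    fun t₀ (_ : t₀ ∈ (univ : Finset K)) => X_sub_C_pow_dvd_aeval_line a b t₀ g (h t₀)
  have hdegprod : (∏ t₀ ∈ (univ : Finset K), (Polynomial.X - Polynomial.C t₀) ^ m).natDegree =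
      m * Fintype.card K := by
    rw [Polynomial.natDegree_prod_of_monic _ _ fun t₀ _ => (Polynomial.monic_X_sub_C t₀).pow m]
    simp only [Polynomial.natDegree_pow, Polynomial.natDegree_X_sub_C, mul_one, sum_const,
      card_univ, smul_eq_mul, mul_comm]
  have h1 := Polynomial.natDegree_le_of_dvd hdvd hP
  have h2 := Extremal.natDegree_aeval_line_le a b g
  rw [hdegprod] at h1
  omega

/-! ### The monomial counts `N_q(n, m)` -/

/-- The exponent vectors `s ∈ ℕⁿ` with every entry `< q` (individual degree at most `q − 1`).
[cite: SarafSudan2008KakeyaFiniteFields, §1 (p. 376)] -/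
noncomputable def boxExps (q n : ℕ) : Finset (Fin n →₀ ℕ) :=
  (univ : Finset (Fin n → Fin q)).image fun f => Finsupp.equivFunOnFinite.symm fun i => (f i : ℕ)

/-- The exponent vectors with every entry `≤ q − 1` and total degree `< mq`.
[cite: SarafSudan2008KakeyaFiniteFields, §1 (p. 376)] -/
noncomputable def admExps (q n m : ℕ) : Finset (Fin n →₀ ℕ) :=
  (boxExps q n).filter fun s => s.degree < m * q

/-- **`N_q(n, m)`**: the number of monomials in `n` variables of total degree less than `mq` and of
individual degree at most `q − 1` in each variable. [cite: SarafSudan2008KakeyaFiniteFields, §1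
(p. 376)] -/
noncomputable def Nq (q n m : ℕ) : ℕ :=
  (admExps q n m).card

/-- Membership in `boxExps`. [folklore] -/
theorem mem_boxExps {q n : ℕ} {s : Fin n →₀ ℕ} : s ∈ boxExps q n ↔ ∀ i, s i < q := by
  constructor
  · intro h i
    obtain ⟨f, -, rfl⟩ := mem_image.1 h
    simp only [Finsupp.coe_equivFunOnFinite_symm]
    exact (f i).isLt
  · intro h
    exact mem_image.2 ⟨fun i => ⟨s i, h i⟩, mem_univ _, by ext i; simp⟩

/-- Membership in `admExps`. [folklore] -/
theorem mem_admExps {q n m : ℕ} {s : Fin n →₀ ℕ} :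
    s ∈ admExps q n m ↔ (∀ i, s i < q) ∧ s.degree < m * q := by
  rw [admExps, mem_filter, mem_boxExps]

/-- There are `qⁿ` exponent vectors with entries `< q`. [folklore] -/
theorem card_boxExps (q n : ℕ) : (boxExps q n).card = q ^ n := by
  rw [boxExps, card_image_of_injective, card_univ, Fintype.card_fun, Fintype.card_fin,
    Fintype.card_fin]
  intro f g hfg
  funext i
  apply Fin.ext
  have := DFunLike.congr_fun hfg i
  simpa only [Finsupp.coe_equivFunOnFinite_symm] using this

/-- `N_q(n, m) ≤ qⁿ`. [folklore] -/
theorem Nq_le (q n m : ℕ) : Nq q n m ≤ q ^ n :=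
  (card_filter_le _ _).trans (card_boxExps q n).le

/-- `N_q(n, 0) = 0` (no monomial has negative degree). [folklore] -/
theorem Nq_zero (q n : ℕ) : Nq q n 0 = 0 := by
  rw [Nq, admExps, Finset.card_eq_zero, filter_eq_empty_iff]
  intro s _
  simp

/-- **`N_q(n, n) = qⁿ`** for `n ≥ 1` ("there are `q` choices for the individual degree of every
variable in an `n` variate monomial, and this already forces total degree to be at most `nq`" —
indeed at most `n(q − 1) < nq`). [cite: SarafSudan2008KakeyaFiniteFields, proof of Theorem 1
(§2, p. 377)] -/
theorem Nq_self {q n : ℕ} (hn : 0 < n) : Nq q n n = q ^ n := by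
  rw [Nq, admExps, filter_true_of_mem, card_boxExps]
  intro s hs
  rw [mem_boxExps] at hs
  rcases Nat.eq_zero_or_pos q with rfl | hq
  · exact absurd (hs ⟨0, hn⟩) (Nat.not_lt_zero _)
  · rw [Finsupp.degree_eq_sum]
    calc ∑ i, s i ≤ ∑ _i : Fin n, (q - 1) := sum_le_sum fun i _ => Nat.le_sub_one_of_lt (hs i)
      _ = n * (q - 1) := by simp
      _ < n * q := (Nat.mul_lt_mul_left hn).2 (Nat.sub_lt hq one_pos)

/-! ### Proposition 3: interpolation with multiplicity -/

/-- **Proposition 3** ("the number of possible coefficients for `g` is `N_q(n, m)` and the number of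
(homogeneous) linear constraints is `C(m + n − 1, n) |S| < N_q(n, m)` […] there is a nontrivial
solution"): if `C(m + n − 1, n) · |S| < N_q(n, m)` (`m ≥ 1`), some nonzero polynomial supported on
the monomials counted by `N_q(n, m)` (total degree `< mq`, individual degrees `≤ q − 1`) has a zero
of multiplicity `m` at every point of `S`.  The constraints at `a ∈ S` are the vanishing of the
coefficients of `x^e`, `|e| ≤ m − 1`, of `g(x + a)`; they are indexed by the exponents `f` on
`n + 1` letters with `|f| = m − 1` (`e = f ∘ some`). [cite: SarafSudan2008KakeyaFiniteFields,
Proposition 3 (§1, p. 376)] -/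
theorem exists_vanishesToOrder {n : ℕ} (q : ℕ) {m : ℕ} (hm : 0 < m) (S : Finset (Fin n → K))
    (hS : (m + n - 1).choose n * S.card < Nq q n m) :
    ∃ g : MvPolynomial (Fin n) K, g ≠ 0 ∧
      g ∈ restrictSupport K (↑(admExps q n m) : Set (Fin n →₀ ℕ)) ∧
      ∀ a ∈ S, VanishesToOrder g a m := by
  classical
  set A : Set (Fin n →₀ ℕ) := ↑(admExps q n m) with hA
  set V : Submodule K (MvPolynomial (Fin n) K) := restrictSupport K A with hV
  set B : Finset (Option (Fin n) →₀ ℕ) :=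
    (univ : Finset (Option (Fin n))).finsuppAntidiag (m - 1) with hB
  let Φ : V →ₗ[K] (↥S × ↥B → K) :=
    LinearMap.pi fun p : ↥S × ↥B =>
      (lcoeff K p.2.1.some).comp
        ((aeval (R := K) fun i => X i + C (p.1.1 i)).toLinearMap.comp V.subtype)
  have hBcard : B.card = (m + n - 1).choose n := by
    rw [hB, card_finsuppAntidiag_nat_eq_choose, card_univ, Fintype.card_option, Fintype.card_fin,
      show n + 1 + (m - 1) - 1 = (m - 1) + n by omega, Nat.choose_symm_add,
      show m - 1 + n = m + n - 1 by omega]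
  have hdimV : Module.finrank K V = Nq q n m := by
    rw [Module.finrank_eq_nat_card_basis (basisRestrictSupport K A), Nat.card_coe_set_eq, hA,
      Set.ncard_coe_finset, Nq]
  have hdimW : Module.finrank K (↥S × ↥B → K) = (m + n - 1).choose n * S.card := by
    rw [Module.finrank_fintype_fun_eq_card, Fintype.card_prod, Fintype.card_coe, Fintype.card_coe,
      hBcard, mul_comm]
  have hlt : Module.finrank K (↥S × ↥B → K) < Module.finrank K V := by
    rw [hdimW, hdimV]
    exact hS
  haveI : Module.Finite K V := Module.Finite.of_basis (basisRestrictSupport K A)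
  obtain ⟨g, hgker, hg0⟩ :=
    (Submodule.ne_bot_iff _).1 (LinearMap.ker_ne_bot_of_finrank_lt (f := Φ) hlt)
  refine ⟨g.1, fun h => hg0 (Subtype.ext h), g.2, fun a ha s hs => ?_⟩
  by_contra hlt'
  have hsd : s.degree ≤ m - 1 := by omega
  -- the exponent `f` on `n + 1` letters extending `s` with total degree `m - 1`
  let f : Option (Fin n) →₀ ℕ :=
    Finsupp.equivFunOnFinite.symm fun o => o.elim (m - 1 - s.degree) s
  have hfs : f.some = s := by
    ext i
    simp [f, Finsupp.some_apply]
  have hfB : f ∈ B := by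
    rw [hB, mem_finsuppAntidiag]
    refine ⟨?_, Finset.subset_univ _⟩
    rw [Fintype.sum_option]
    simp only [f, Finsupp.coe_equivFunOnFinite_symm, Option.elim]
    rw [← Finsupp.degree_eq_sum]
    omega
  have hΦ : Φ g = 0 := LinearMap.mem_ker.1 hgker
  have hc := congr_fun hΦ (⟨a, ha⟩, ⟨f, hfB⟩)
  simp only [Φ, LinearMap.pi_apply, LinearMap.comp_apply, Submodule.subtype_apply,
    AlgHom.toLinearMap_apply, lcoeff_apply, Pi.zero_apply, hfs] at hc
  exact (mem_support_iff.1 hs) hc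

/-! ### Lemma 6 and Theorem 1 -/

/-- **Lemma 6:** if `K ⊆ 𝔽_qⁿ` is a Kakeya set then `N_q(n, m) ≤ C(m + n − 1, n) · |K|` for every
`m` (printed: `|K| ≥ C(m + n − 1, n)⁻¹ N_q(n, m)`).  Proof as printed: otherwise Proposition 3
gives a nonzero `g` of degree `d < mq`, individual degrees `≤ q − 1`, with multiplicity `m` on `K`;
for every direction `b` the restriction `g_{a,b}` to a line of `K` vanishes identically
(Proposition 4 and the zero count), so its leading coefficient `g₀(b)` vanishes (Proposition 5);
then `g₀ ≡ 0` by Fact 2 — a contradiction. [cite: SarafSudan2008KakeyaFiniteFields, Lemma 6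
(§2, p. 377)] -/
theorem Nq_le_choose_mul_card [Fintype K] {n : ℕ} {S : Finset (Fin n → K)}
    (hK : IsKakeya (↑S : Set (Fin n → K))) (m : ℕ) :
    Nq (Fintype.card K) n m ≤ (m + n - 1).choose n * S.card := by
  classical
  rcases Nat.eq_zero_or_pos m with rfl | hm
  · rw [Nq_zero]
    exact Nat.zero_le _
  by_contra! hlt
  set q := Fintype.card K with hq
  have hq1 : 1 ≤ q := Fintype.card_pos
  obtain ⟨g, hg0, hgV, hmult⟩ := exists_vanishesToOrder q hm S hlt
  have hsupp : ∀ s ∈ g.support, (∀ i, s i < q) ∧ s.degree < m * q := fun s hs =>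
    mem_admExps.1 (Finset.mem_coe.1 ((mem_restrictSupport_iff K).1 hgV hs))
  set d := g.totalDegree with hd
  have hdlt : d < m * q := by
    rw [hd, totalDegree]
    refine (Finset.sup_lt_iff (Nat.pos_iff_ne_zero.1 (Nat.mul_pos hm hq1) |>.bot_lt)).2
      fun s hs => ?_
    have := (hsupp s hs).2
    rwa [Finsupp.degree_apply] at this
  -- the leading form `g₀`
  have hg₀ : homogeneousComponent d g ≠ 0 := homogeneousComponent_totalDegree_ne_zero hg0
  have hg₀deg : ∀ i, degreeOf i (homogeneousComponent d g) < q := by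
    intro i
    refine (degreeOf_lt_iff hq1).2 fun s hs => (hsupp s ?_).1 i
    rw [mem_support_iff, coeff_homogeneousComponent] at hs
    rw [mem_support_iff]
    intro h0
    exact hs (by rw [h0, ite_self])
  have hg₀eval : ∀ b : Fin n → K, eval b (homogeneousComponent d g) = 0 := by
    intro b
    obtain ⟨a, ha⟩ := hK b
    have hP : aeval (fun i => Polynomial.C (a i) + Polynomial.C (b i) * Polynomial.X) g = 0 :=
      aeval_line_eq_zero_of_vanishesToOrder a b g hdlt
        fun t₀ => hmult _ (Finset.mem_coe.1 (ha t₀))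
    have hc := coeff_aeval_line a b g (le_refl d)
    rwa [hP, Polynomial.coeff_zero, eq_comm] at hc
  exact hg₀ (eq_zero_of_forall_eval_eq_zero _ hg₀deg hg₀eval)

/-- **Theorem 1, as proved (`m = n`): every Kakeya set `K ⊆ 𝔽_qⁿ` satisfies
`qⁿ ≤ C(2n − 1, n) · |K|`** (Lemma 6 with `m = n` and `N_q(n, n) = qⁿ`; for `n = 0` both sides
are `1 ≤ |K|`). [cite: SarafSudan2008KakeyaFiniteFields, Theorem 1 (p. 375; proof §2, p. 377)] -/
theorem pow_le_choose_mul_card [Fintype K] {n : ℕ} {S : Finset (Fin n → K)}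
    (hK : IsKakeya (↑S : Set (Fin n → K))) :
    Fintype.card K ^ n ≤ (2 * n - 1).choose n * S.card := by
  rcases Nat.eq_zero_or_pos n with rfl | hn
  · obtain ⟨x, hx⟩ := hK.nonempty
    have : 0 < S.card := Finset.card_pos.2 ⟨x, Finset.mem_coe.1 hx⟩
    simpa using this
  · have h := Nq_le_choose_mul_card hK n
    rwa [Nq_self hn, show n + n - 1 = 2 * n - 1 by omega] at h

/-- **Theorem 1 with `c₀ = 1`, `c₁ = 1/4`: every Kakeya set `K ⊆ 𝔽_qⁿ` has `qⁿ ≤ 4ⁿ · |K|`,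
i.e. `|K| ≥ (q/4)ⁿ`** (`C(2n − 1, n) ≤ 2^{2n−1} ≤ 4ⁿ`).
[cite: SarafSudan2008KakeyaFiniteFields, Theorem 1 (p. 375; proof §2, p. 377)] -/
theorem pow_le_four_pow_mul_card [Fintype K] {n : ℕ} {S : Finset (Fin n → K)}
    (hK : IsKakeya (↑S : Set (Fin n → K))) :
    Fintype.card K ^ n ≤ 4 ^ n * S.card := by
  refine (pow_le_choose_mul_card hK).trans (Nat.mul_le_mul_right _ ?_)
  calc (2 * n - 1).choose n ≤ 2 ^ (2 * n - 1) := Nat.choose_le_two_pow _ _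
    _ ≤ 2 ^ (2 * n) := Nat.pow_le_pow_right (by norm_num) (by omega)
    _ = 4 ^ n := by rw [pow_mul]; norm_num

/-- Theorem 1 (`m = n`) for a `Set`: `qⁿ ≤ C(2n − 1, n) · |K|`.
[cite: SarafSudan2008KakeyaFiniteFields, Theorem 1 (p. 375; proof §2, p. 377)] -/
theorem pow_le_choose_mul_ncard [Fintype K] {n : ℕ} {S : Set (Fin n → K)} (hK : IsKakeya S) :
    Fintype.card K ^ n ≤ (2 * n - 1).choose n * S.ncard := by
  classical
  rw [Set.ncard_eq_toFinset_card' S]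
  exact pow_le_choose_mul_card (by rwa [Set.coe_toFinset])

/-- Theorem 1 for a `Set`: `qⁿ ≤ 4ⁿ · |K|`. [cite: SarafSudan2008KakeyaFiniteFields, Theorem 1
(p. 375)] -/
theorem pow_le_four_pow_mul_ncard [Fintype K] {n : ℕ} {S : Set (Fin n → K)} (hK : IsKakeya S) :
    Fintype.card K ^ n ≤ 4 ^ n * S.ncard := by
  classical
  rw [Set.ncard_eq_toFinset_card' S]
  exact pow_le_four_pow_mul_card (by rwa [Set.coe_toFinset])

/-! ### The second choice `m = ⌈n/2⌉` -/

/-- **"At least half the monomials of individual degree at most `q − 1` have degree at most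
`nq/2`"** (proof of Theorem 1, p. 377): `qⁿ ≤ 2 N_q(n, m)` whenever `n ≤ 2m` (`m, q ≥ 1`).  The
involution `s ↦ (q − 1 − sᵢ)ᵢ` of the box has `deg s + deg s' = n(q − 1) < 2mq`, so it maps the
monomials of degree `≥ mq` injectively into those of degree `< mq`.
[cite: SarafSudan2008KakeyaFiniteFields, proof of Theorem 1 (§2, p. 377)] -/
theorem pow_le_two_mul_Nq {q n m : ℕ} (hq : 0 < q) (hm : 0 < m) (hnm : n ≤ 2 * m) :
    q ^ n ≤ 2 * Nq q n m := by
  classical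
  set P : (Fin n →₀ ℕ) → Prop := fun s => s.degree < m * q with hP
  let σ : (Fin n →₀ ℕ) → (Fin n →₀ ℕ) := fun s =>
    Finsupp.equivFunOnFinite.symm fun i => q - 1 - s i
  have hσ : ∀ s : Fin n →₀ ℕ, ∀ i, σ s i = q - 1 - s i := fun s i => by
    simp [σ]
  -- degree of the reflected exponent
  have hdeg : ∀ s ∈ boxExps q n, (σ s).degree + s.degree = n * (q - 1) := by
    intro s hs
    rw [mem_boxExps] at hs
    rw [Finsupp.degree_eq_sum, Finsupp.degree_eq_sum, ← sum_add_distrib]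
    rw [Finset.sum_congr rfl fun i _ => show σ s i + s i = q - 1 by
      rw [hσ]; have := hs i; omega]
    simp
  have hlt : n * (q - 1) < 2 * (m * q) := by
    rcases Nat.eq_zero_or_pos n with rfl | hn
    · simp only [zero_mul]
      positivity
    · calc n * (q - 1) < n * q := (Nat.mul_lt_mul_left hn).2 (Nat.sub_lt hq one_pos)
        _ ≤ 2 * m * q := Nat.mul_le_mul_right _ hnm
        _ = 2 * (m * q) := mul_assoc _ _ _
  have hmaps : ∀ s ∈ (boxExps q n).filter (fun s => ¬ P s),
      σ s ∈ (boxExps q n).filter P := by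
    intro s hs
    rw [mem_filter] at hs ⊢
    have hbox := hs.1
    rw [mem_boxExps] at hbox
    refine ⟨mem_boxExps.2 fun i => by rw [hσ]; omega, ?_⟩
    have h1 := hdeg s hs.1
    have h2 : ¬ s.degree < m * q := hs.2
    show (σ s).degree < m * q
    omega
  have hinj : Set.InjOn σ ↑((boxExps q n).filter (fun s => ¬ P s)) := by
    intro s hs s' hs' h
    rw [Finset.coe_filter, Set.mem_setOf_eq, mem_boxExps] at hs hs'
    ext i
    have := DFunLike.congr_fun h i
    rw [hσ, hσ] at this
    have h1 := hs.1 i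
    have h2 := hs'.1 i
    omega
  have hle : ((boxExps q n).filter (fun s => ¬ P s)).card ≤ ((boxExps q n).filter P).card :=
    Finset.card_le_card_of_injOn σ hmaps hinj
  have hsplit := Finset.card_filter_add_card_filter_not (s := boxExps q n) P
  rw [card_boxExps] at hsplit
  have hA : ((boxExps q n).filter P).card = Nq q n m := rfl
  omega

/-- **Theorem 1 with the second choice of `m`** ("A better choice is with `m = ⌈n/2⌉` […]
`N_q(n, m) ≥ ½ qⁿ` […]. This leads to a bound of `|K| ≥ ½ C(3n/2, n)⁻¹ qⁿ`", p. 377): for every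
`m ≥ 1` with `n ≤ 2m`, every Kakeya set `K ⊆ 𝔽_qⁿ` has `qⁿ ≤ 2 C(m + n − 1, n) · |K|`.
[cite: SarafSudan2008KakeyaFiniteFields, proof of Theorem 1 (§2, p. 377)] -/
theorem pow_le_two_mul_choose_mul_card [Fintype K] {n : ℕ} {S : Finset (Fin n → K)}
    (hK : IsKakeya (↑S : Set (Fin n → K))) {m : ℕ} (hm : 0 < m) (hnm : n ≤ 2 * m) :
    Fintype.card K ^ n ≤ 2 * (m + n - 1).choose n * S.card :=
  calc Fintype.card K ^ n ≤ 2 * Nq (Fintype.card K) n m :=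
      pow_le_two_mul_Nq Fintype.card_pos hm hnm
    _ ≤ 2 * ((m + n - 1).choose n * S.card) := Nat.mul_le_mul_left _ (Nq_le_choose_mul_card hK m)
    _ = 2 * (m + n - 1).choose n * S.card := (mul_assoc _ _ _).symm

/-- Theorem 1 with `m = ⌈n/2⌉ = ⌊(n + 1)/2⌋`: every Kakeya set `K ⊆ 𝔽_qⁿ` has
`qⁿ ≤ 2 C(⌈n/2⌉ + n − 1, n) · |K|` (the printed `|K| ≥ ½ C(3n/2, n)⁻¹ qⁿ`; the numerical form
`½ (q/2.6)ⁿ` is not formalized). [cite: SarafSudan2008KakeyaFiniteFields, proof of Theorem 1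
(§2, p. 377)] -/
theorem pow_le_two_mul_choose_half_mul_card [Fintype K] {n : ℕ} {S : Finset (Fin n → K)}
    (hK : IsKakeya (↑S : Set (Fin n → K))) :
    Fintype.card K ^ n ≤ 2 * ((n + 1) / 2 + n - 1).choose n * S.card := by
  rcases Nat.eq_zero_or_pos n with rfl | hn
  · obtain ⟨x, hx⟩ := hK.nonempty
    have : 0 < S.card := Finset.card_pos.2 ⟨x, Finset.mem_coe.1 hx⟩
    simp only [pow_zero, Nat.choose_zero_right, mul_one]
    omega
  · exact pow_le_two_mul_choose_mul_card hK (by omega) (by omega)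

end FiniteFieldKakeya

end Literature.Combinatorics.Kakeya
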